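import Mathlib.Algebra.MvPolynomial.PDeriv
import Mathlib.Algebra.Algebra.Bilinear
import Mathlib.Algebra.Lie.OfAssociative
import Mathlib.Data.Matrix.Mul
import HarnessLib

/-!
# The operators `E_ij`, `M_ij`, `Δ_ij` of `O(n)`–`𝔰𝔭(k)` Howe duality

Goodman–Wallach, *Symmetry, Representations, and Invariants* (GTM 255), § 5.6.2 (5.75) and
§ 5.6.3, Theorem 5.6.9 with its proof, (5.78)–(5.83) [GoodmanWallachGTM255]. On the polynomial
ring `𝒫(M_{n,k}) = R[x_{pi} : p ∈ τ, i ∈ ι]` (`MvPolynomial (τ × ι) R`, `τ` finite of size `n`,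
`ι` arbitrary) consider, for `i j ∈ ι`, the operators

* `E_ij = ∑_p x_{pi} ∂/∂x_{pj}` (5.75) (the `𝔤𝔩(k)` vector fields),
* `M_ij =` multiplication by `∑_p x_{pi} x_{pj}` (the `O(n)`-invariant quadrics `(x_i, x_j)`),
* `Δ_ij = ∑_p ∂²/∂x_{pi}∂x_{pj}` (the `O(n)`-invariant Laplacians).

As in the companion file `SphericalHarmonics` (the case `k = 1`) the operators are passed as
hypotheses (`hE`, `hM`, `hΔ` below) so that any incarnation can be plugged in. Everything is
proved, over an arbitrary commutative ring `R`; no definitions, no named facts. Kronecker deltas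
are written `(if i = j then (1 : R) else 0) • _`.

* § 1 `M_symm`, `laplacian_symm`, `laplacian_comm`, `M_mul_comm` — `M_ij = M_ji`, `Δ_ij = Δ_ji`,
  (5.79) `[Δ_ij, Δ_rs] = 0 = [M_ij, M_rs]`;
* § 2 the commutation relations of Theorem 5.6.9: `laplacian_M_comm` (5.80),
  `euler_euler_comm` (5.81), `euler_M_comm` (5.82), `euler_laplacian_comm` (5.83), applied to a
  polynomial `f`, and as commutator brackets in `End_R 𝒫` (`lie_laplacian_laplacian`, `lie_M_M`,
  `lie_laplacian_M`, `lie_euler_euler`, `lie_euler_M`, `lie_euler_laplacian`) — so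
  `Span{E_ij + (n/2)δ_ij, M_ij, Δ_ij}` is a Lie subalgebra of `𝔻(V)` (≅ `𝔰𝔭(k)`);
* § 3 invariance under the left action of `GL(n)` / `O(n)` by linear substitution
  `x ↦ a x` (`f ↦ aeval v f`, `v (p,i) = ∑_q a_{pq} x_{qi}`): `pderiv_aeval_linSubst` (the
  display `ρ(g) ∂/∂x_{pi} ρ(g)⁻¹ = ∑_q g_{qp} ∂/∂x_{qi}` of § 5.6.3), `euler_aeval_linSubst`
  (`E_ij` commutes with all of `GL(n)`), `aeval_linSubst_M` and `laplacian_aeval_linSubst`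
  (`M_ij`, `Δ_ij ∈ 𝔻(V)^{O(n)}`: invariance under `a` with `a aᵀ = 1`).

References: R. Goodman, N. R. Wallach, GTM 255, Springer 2009, § 5.6.2 (5.75), § 5.6.3,
Theorem 5.6.9, (5.79)–(5.83) [GoodmanWallachGTM255].
-/

open MvPolynomial
open scoped BigOperators

universe u v w

namespace Literature.RepresentationTheory.ClassicalInvariants.OnSpDualityOperators

variable {R : Type u} [CommRing R] {τ : Type v} {ι : Type w} [Fintype τ] [DecidableEq τ]
  [DecidableEq ι]

/-! ## § 0. Calculus helpers -/

omit [Fintype τ] in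
/-- Partial derivatives in the variables `x_{pi}` commute. [folklore] -/
private theorem pderiv_comm' (a b : τ × ι) (f : MvPolynomial (τ × ι) R) :
    pderiv a (pderiv b f) = pderiv b (pderiv a f) := by
  rcases eq_or_ne a b with rfl | hab
  · rfl
  ext m
  simp only [coeff_pderiv, Finsupp.add_apply, Finsupp.single_apply, if_neg hab,
    if_neg hab.symm, add_zero]
  rw [add_right_comm m (Finsupp.single a 1) (Finsupp.single b 1)]
  ring

omit [Fintype τ] in
/-- `∂_{pj} x_{qs} = δ_{qp} δ_{sj}`. [folklore] -/
private theorem pderiv_X_pair (p q : τ) (j s : ι) :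
    pderiv (p, j) (X (q, s) : MvPolynomial (τ × ι) R) = if q = p ∧ s = j then 1 else 0 := by
  rw [pderiv_X]
  simp [Pi.single_apply, Prod.ext_iff]

omit [Fintype τ] [DecidableEq τ] [DecidableEq ι] in
/-- Second-order Leibniz rule. [folklore] -/
private theorem pderiv_pderiv_mul (a b : τ × ι) (φ f : MvPolynomial (τ × ι) R) :
    pderiv a (pderiv b (φ * f)) =
      pderiv a (pderiv b φ) * f + pderiv b φ * pderiv a f + pderiv a φ * pderiv b f +
        φ * pderiv a (pderiv b f) := by
  rw [pderiv_mul, map_add, pderiv_mul, pderiv_mul]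
  ring

/-- `∂_{pj} M_rs = δ_{rj} x_{ps} + δ_{sj} x_{pr}`. [folklore] -/
private theorem pderiv_M (M : ι → ι → MvPolynomial (τ × ι) R)
    (hM : ∀ i j, M i j = ∑ p : τ, X (p, i) * X (p, j)) (p : τ) (j r s : ι) :
    pderiv (p, j) (M r s) =
      (if r = j then (1 : R) else 0) • X (p, s) + (if s = j then (1 : R) else 0) • X (p, r) := by
  rw [hM, map_sum, Finset.sum_eq_single p]
  · rw [pderiv_mul, pderiv_X_pair, pderiv_X_pair]
    simp only [true_and]
    simp only [ite_mul, one_mul, zero_mul, mul_ite, mul_one, mul_zero, ite_smul, one_smul,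
      zero_smul]
  · intro q _ hqp
    rw [pderiv_mul, pderiv_X_pair, pderiv_X_pair, if_neg (fun h => hqp h.1),
      if_neg (fun h => hqp h.1), zero_mul, mul_zero, add_zero]
  · intro h; exact absurd (Finset.mem_univ p) h

/-- `∂_{pi} ∂_{pj} M_rs = δ_{rj} δ_{si} + δ_{sj} δ_{ri}`. [folklore] -/
private theorem pderiv_pderiv_M (M : ι → ι → MvPolynomial (τ × ι) R)
    (hM : ∀ i j, M i j = ∑ p : τ, X (p, i) * X (p, j)) (p : τ) (i j r s : ι) :
    pderiv (p, i) (pderiv (p, j) (M r s)) =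
      ((if r = j then (1 : R) else 0) * (if s = i then (1 : R) else 0) +
        (if s = j then (1 : R) else 0) * (if r = i then (1 : R) else 0)) •
        (1 : MvPolynomial (τ × ι) R) := by
  rw [pderiv_M M hM, map_add, Derivation.map_smul, Derivation.map_smul, pderiv_X_pair,
    pderiv_X_pair]
  simp only [true_and, add_smul, mul_smul]
  congr 1
  · by_cases h : s = i <;> simp [h]
  · by_cases h : r = i <;> simp [h]

omit [DecidableEq τ] [DecidableEq ι] in
/-- `E_ij` is a derivation: `E_ij (g f) = (E_ij g) f + g (E_ij f)`. [folklore] -/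
private theorem E_mul (E : ι → ι → MvPolynomial (τ × ι) R →ₗ[R] MvPolynomial (τ × ι) R)
    (hE : ∀ i j f, E i j f = ∑ p : τ, X (p, i) * pderiv (p, j) f) (i j : ι)
    (g f : MvPolynomial (τ × ι) R) : E i j (g * f) = E i j g * f + g * E i j f := by
  rw [hE, hE, hE, Finset.sum_mul, Finset.mul_sum, ← Finset.sum_add_distrib]
  refine Finset.sum_congr rfl fun p _ => ?_
  rw [pderiv_mul]; ring

/-- `E_ij x_{qs} = δ_{sj} x_{qi}`. [folklore] -/
private theorem E_X (E : ι → ι → MvPolynomial (τ × ι) R →ₗ[R] MvPolynomial (τ × ι) R)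
    (hE : ∀ i j f, E i j f = ∑ p : τ, X (p, i) * pderiv (p, j) f) (i j : ι) (q : τ) (s : ι) :
    E i j (X (q, s)) = (if s = j then (1 : R) else 0) • X (q, i) := by
  rw [hE, Finset.sum_eq_single q]
  · rw [pderiv_X_pair]
    simp only [true_and, mul_ite, mul_one, mul_zero, ite_smul, one_smul, zero_smul]
  · intro p _ hpq
    rw [pderiv_X_pair, if_neg (fun h => hpq h.1.symm), mul_zero]
  · intro h; exact absurd (Finset.mem_univ q) h

/-- `E_ij M_rs = δ_{rj} M_is + δ_{sj} M_ir` (as polynomials). [folklore] -/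
private theorem E_M (E : ι → ι → MvPolynomial (τ × ι) R →ₗ[R] MvPolynomial (τ × ι) R)
    (hE : ∀ i j f, E i j f = ∑ p : τ, X (p, i) * pderiv (p, j) f)
    (M : ι → ι → MvPolynomial (τ × ι) R) (hM : ∀ i j, M i j = ∑ p : τ, X (p, i) * X (p, j))
    (i j r s : ι) :
    E i j (M r s) = (if r = j then (1 : R) else 0) • M i s + (if s = j then (1 : R) else 0) • M r i := by
  rw [hM r s, map_sum]
  simp_rw [E_mul E hE, E_X E hE]
  rw [hM i s, hM r i, Finset.smul_sum, Finset.smul_sum, ← Finset.sum_add_distrib]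
  refine Finset.sum_congr rfl fun p _ => ?_
  rw [smul_mul_assoc, mul_smul_comm]

/-! ## § 1. Symmetry and (5.79) -/

omit [DecidableEq τ] [DecidableEq ι] in
/-- `M_ij = M_ji`. [cite: GoodmanWallachGTM255, §5.6.3 ("Note that Δ_ij = Δ_ji and M_ij = M_ji")] -/
theorem M_symm (M : ι → ι → MvPolynomial (τ × ι) R)
    (hM : ∀ i j, M i j = ∑ p : τ, X (p, i) * X (p, j)) (i j : ι) : M i j = M j i := by
  rw [hM, hM]
  exact Finset.sum_congr rfl fun p _ => mul_comm _ _

omit [DecidableEq τ] [DecidableEq ι] in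
/-- `Δ_ij = Δ_ji`. [cite: GoodmanWallachGTM255, §5.6.3 ("Note that Δ_ij = Δ_ji and M_ij = M_ji")] -/
theorem laplacian_symm (Δ : ι → ι → MvPolynomial (τ × ι) R →ₗ[R] MvPolynomial (τ × ι) R)
    (hΔ : ∀ i j f, Δ i j f = ∑ p : τ, pderiv (p, i) (pderiv (p, j) f)) (i j : ι)
    (f : MvPolynomial (τ × ι) R) : Δ i j f = Δ j i f := by
  classical
  rw [hΔ, hΔ]
  exact Finset.sum_congr rfl fun p _ => pderiv_comm' _ _ _

omit [DecidableEq τ] [DecidableEq ι] in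
/-- **(5.79), first relation** `[Δ_ij, Δ_rs] = 0`.
[cite: GoodmanWallachGTM255, Theorem 5.6.9 (proof, (5.79))] -/
theorem laplacian_comm (Δ : ι → ι → MvPolynomial (τ × ι) R →ₗ[R] MvPolynomial (τ × ι) R)
    (hΔ : ∀ i j f, Δ i j f = ∑ p : τ, pderiv (p, i) (pderiv (p, j) f)) (i j r s : ι)
    (f : MvPolynomial (τ × ι) R) : Δ i j (Δ r s f) = Δ r s (Δ i j f) := by
  classical
  rw [hΔ i j, hΔ r s f, hΔ r s, hΔ i j f]
  simp_rw [map_sum]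
  rw [Finset.sum_comm]
  refine Finset.sum_congr rfl fun q _ => Finset.sum_congr rfl fun p _ => ?_
  -- `∂_{pi} ∂_{pj} ∂_{qr} ∂_{qs} = ∂_{qr} ∂_{qs} ∂_{pi} ∂_{pj}`
  rw [pderiv_comm' (p, j) (q, r), pderiv_comm' (p, j) (q, s), pderiv_comm' (p, i) (q, r),
    pderiv_comm' (p, i) (q, s)]

omit [Fintype τ] [DecidableEq τ] [DecidableEq ι] in
/-- **(5.79), second relation** `[M_ij, M_rs] = 0` (multiplication operators commute).
[cite: GoodmanWallachGTM255, Theorem 5.6.9 (proof, (5.79))] -/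
theorem M_mul_comm (M : ι → ι → MvPolynomial (τ × ι) R) (i j r s : ι)
    (f : MvPolynomial (τ × ι) R) : M i j * (M r s * f) = M r s * (M i j * f) := by
  ring

/-! ## § 2. The commutation relations (5.80)–(5.83) -/

/-- **(5.80)** `[Δ_ij, M_rs] = δ_ri E_sj + δ_si E_rj + δ_rj E_si + δ_sj E_ri + n(δ_ri δ_sj + δ_si δ_rj)`
(the book writes the scalar as `(n/2)` distributed over the four shifted operators
`E_ab + (n/2)δ_ab`), applied to `f`. [cite: GoodmanWallachGTM255, Theorem 5.6.9 (proof, (5.80))] -/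
theorem laplacian_M_comm (Δ : ι → ι → MvPolynomial (τ × ι) R →ₗ[R] MvPolynomial (τ × ι) R)
    (hΔ : ∀ i j f, Δ i j f = ∑ p : τ, pderiv (p, i) (pderiv (p, j) f))
    (M : ι → ι → MvPolynomial (τ × ι) R) (hM : ∀ i j, M i j = ∑ p : τ, X (p, i) * X (p, j))
    (E : ι → ι → MvPolynomial (τ × ι) R →ₗ[R] MvPolynomial (τ × ι) R)
    (hE : ∀ i j f, E i j f = ∑ p : τ, X (p, i) * pderiv (p, j) f) (i j r s : ι)
    (f : MvPolynomial (τ × ι) R) :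
    Δ i j (M r s * f) - M r s * Δ i j f =
      (if r = i then (1 : R) else 0) • E s j f + (if s = i then (1 : R) else 0) • E r j f +
        (if r = j then (1 : R) else 0) • E s i f + (if s = j then (1 : R) else 0) • E r i f +
        ((Fintype.card τ : R) * ((if r = i then (1 : R) else 0) * (if s = j then (1 : R) else 0) +
          (if s = i then (1 : R) else 0) * (if r = j then (1 : R) else 0))) • f := by
  -- per-row identity
  have hp : ∀ p : τ, pderiv (p, i) (pderiv (p, j) (M r s * f)) - M r s * pderiv (p, i) (pderiv (p, j) f) =
      (if r = i then (1 : R) else 0) • (X (p, s) * pderiv (p, j) f) +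
        (if s = i then (1 : R) else 0) • (X (p, r) * pderiv (p, j) f) +
        (if r = j then (1 : R) else 0) • (X (p, s) * pderiv (p, i) f) +
        (if s = j then (1 : R) else 0) • (X (p, r) * pderiv (p, i) f) +
        (((if r = i then (1 : R) else 0) * (if s = j then (1 : R) else 0) +
          (if s = i then (1 : R) else 0) * (if r = j then (1 : R) else 0))) • f := by
    intro p
    rw [pderiv_pderiv_mul, pderiv_pderiv_M M hM, pderiv_M M hM, pderiv_M M hM]
    simp only [Algebra.smul_def, map_add, map_mul]
    ring
  rw [hΔ, hΔ i j f, Finset.mul_sum, ← Finset.sum_sub_distrib]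
  simp_rw [hp]
  simp only [Finset.sum_add_distrib, ← Finset.smul_sum, ← hE, Finset.sum_const, Finset.card_univ,
    ← Nat.cast_smul_eq_nsmul R, smul_smul]
  congr 2
  exact mul_comm _ _

/-- **(5.81)** `[E_ij, E_rs] = δ_jr E_is − δ_is E_rj` (the `𝔤𝔩(k)` commutation relations; the
shifts `(n/2)δ` cancel), applied to `f` (we write `δ_jr` as `if r = j then 1 else 0`). [cite: GoodmanWallachGTM255, Theorem 5.6.9 (proof, (5.81))] -/
theorem euler_euler_comm (E : ι → ι → MvPolynomial (τ × ι) R →ₗ[R] MvPolynomial (τ × ι) R)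
    (hE : ∀ i j f, E i j f = ∑ p : τ, X (p, i) * pderiv (p, j) f) (i j r s : ι)
    (f : MvPolynomial (τ × ι) R) :
    E i j (E r s f) - E r s (E i j f) =
      (if r = j then (1 : R) else 0) • E i s f - (if i = s then (1 : R) else 0) • E r j f := by
  -- `E_ij (E_rs f) = δ_jr E_is f + ∑_{p,q} x_pi x_qr ∂_pj ∂_qs f`
  have h1 : ∀ (i j r s : ι), E i j (E r s f) =
      (if r = j then (1 : R) else 0) • E i s f +
        ∑ q : τ, ∑ p : τ, X (p, i) * X (q, r) * pderiv (p, j) (pderiv (q, s) f) := by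
    intro i j r s
    rw [hE r s f, map_sum]
    simp_rw [E_mul E hE, E_X E hE]
    rw [Finset.sum_add_distrib, hE i s f, Finset.smul_sum]
    congr 1
    · refine Finset.sum_congr rfl fun q _ => ?_
      rw [smul_mul_assoc]
    · refine Finset.sum_congr rfl fun q _ => ?_
      rw [hE, Finset.mul_sum]
      refine Finset.sum_congr rfl fun p _ => ?_
      ring
  rw [h1 i j r s, h1 r s i j, Finset.sum_comm]
  have h2 : ∑ y : τ, ∑ x : τ, X (y, i) * X (x, r) * pderiv (y, j) (pderiv (x, s) f) =
      ∑ y : τ, ∑ x : τ, X (x, r) * X (y, i) * pderiv (x, s) (pderiv (y, j) f) := by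
    refine Finset.sum_congr rfl fun y _ => Finset.sum_congr rfl fun x _ => ?_
    rw [pderiv_comm' (y, j) (x, s)]; ring
  rw [h2]
  abel

/-- **(5.82)** `[E_ij, M_rs] = δ_jr M_is + δ_js M_ir` (the shift `(n/2)δ_ij` commutes with `M_rs`),
applied to `f`. [cite: GoodmanWallachGTM255, Theorem 5.6.9 (proof, (5.82))] -/
theorem euler_M_comm (E : ι → ι → MvPolynomial (τ × ι) R →ₗ[R] MvPolynomial (τ × ι) R)
    (hE : ∀ i j f, E i j f = ∑ p : τ, X (p, i) * pderiv (p, j) f)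
    (M : ι → ι → MvPolynomial (τ × ι) R) (hM : ∀ i j, M i j = ∑ p : τ, X (p, i) * X (p, j))
    (i j r s : ι) (f : MvPolynomial (τ × ι) R) :
    E i j (M r s * f) - M r s * E i j f =
      ((if r = j then (1 : R) else 0) • M i s + (if s = j then (1 : R) else 0) • M i r) * f := by
  rw [E_mul E hE, E_M E hE M hM, M_symm M hM r i]
  ring

/-- **(5.83)** `[E_ij, Δ_rs] = −δ_ir Δ_js − δ_is Δ_jr` (the shift `(n/2)δ_ij` commutes with
`Δ_rs`), applied to `f`. [cite: GoodmanWallachGTM255, Theorem 5.6.9 (proof, (5.83))] -/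
theorem euler_laplacian_comm (Δ : ι → ι → MvPolynomial (τ × ι) R →ₗ[R] MvPolynomial (τ × ι) R)
    (hΔ : ∀ i j f, Δ i j f = ∑ p : τ, pderiv (p, i) (pderiv (p, j) f))
    (E : ι → ι → MvPolynomial (τ × ι) R →ₗ[R] MvPolynomial (τ × ι) R)
    (hE : ∀ i j f, E i j f = ∑ p : τ, X (p, i) * pderiv (p, j) f) (i j r s : ι)
    (f : MvPolynomial (τ × ι) R) :
    E i j (Δ r s f) - Δ r s (E i j f) =
      -((if i = r then (1 : R) else 0) • Δ j s f) - (if i = s then (1 : R) else 0) • Δ j r f := by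
  -- `Δ_rs (E_ij f) = δ_is Δ_rj f + δ_ir Δ_sj f + E_ij (Δ_rs f)`
  have key : Δ r s (E i j f) =
      (if i = s then (1 : R) else 0) • Δ r j f + (if i = r then (1 : R) else 0) • Δ s j f +
        E i j (Δ r s f) := by
    rw [hE i j f, map_sum, hE i j (Δ r s f), hΔ r s f]
    simp_rw [hΔ r s, pderiv_pderiv_mul, Finset.sum_add_distrib]
    -- the four groups of terms
    have t1 : ∑ p : τ, ∑ q : τ, pderiv (q, r) (pderiv (q, s) (X (p, i))) * pderiv (p, j) f = 0 := by
      refine Finset.sum_eq_zero fun p _ => Finset.sum_eq_zero fun q _ => ?_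
      rw [pderiv_X_pair]
      split_ifs <;> simp
    have t2 : ∑ p : τ, ∑ q : τ, pderiv (q, s) (X (p, i)) * pderiv (q, r) (pderiv (p, j) f) =
        (if i = s then (1 : R) else 0) • Δ r j f := by
      rw [hΔ, Finset.smul_sum]
      refine Finset.sum_congr rfl fun p _ => ?_
      rw [Finset.sum_eq_single p]
      · rw [pderiv_X_pair, pderiv_comm' (p, r) (p, j), pderiv_comm' (p, j) (p, r)]
        simp only [true_and, ite_mul, one_mul, zero_mul, ite_smul, one_smul, zero_smul]
      · intro q _ hqp
        rw [pderiv_X_pair, if_neg (fun h => hqp h.1.symm), zero_mul]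
      · intro h; exact absurd (Finset.mem_univ p) h
    have t3 : ∑ p : τ, ∑ q : τ, pderiv (q, r) (X (p, i)) * pderiv (q, s) (pderiv (p, j) f) =
        (if i = r then (1 : R) else 0) • Δ s j f := by
      rw [hΔ, Finset.smul_sum]
      refine Finset.sum_congr rfl fun p _ => ?_
      rw [Finset.sum_eq_single p]
      · rw [pderiv_X_pair]
        simp only [true_and, ite_mul, one_mul, zero_mul, ite_smul, one_smul, zero_smul]
      · intro q _ hqp
        rw [pderiv_X_pair, if_neg (fun h => hqp h.1.symm), zero_mul]
      · intro h; exact absurd (Finset.mem_univ p) h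
    have t4 : ∑ p : τ, ∑ q : τ, X (p, i) * pderiv (q, r) (pderiv (q, s) (pderiv (p, j) f)) =
        ∑ p : τ, X (p, i) * ∑ q : τ, pderiv (p, j) (pderiv (q, r) (pderiv (q, s) f)) := by
      refine Finset.sum_congr rfl fun p _ => ?_
      rw [Finset.mul_sum]
      refine Finset.sum_congr rfl fun q _ => ?_
      rw [pderiv_comm' (q, s) (p, j), pderiv_comm' (q, r) (p, j)]
    simp_rw [map_sum]
    rw [t1, t2, t3, t4, zero_add]
  rw [key, laplacian_symm Δ hΔ s j, laplacian_symm Δ hΔ r j]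
  abel

/-! ### The relations as brackets in `End_R 𝒫(M_{n,k})`

With `⁅A, B⁆ = AB − BA` the commutator bracket of `Module.End R (MvPolynomial (τ × ι) R)` and
`M_rs` the multiplication operator `LinearMap.mulLeft R (M r s)`, (5.79)–(5.83) say that
`Span{E_ij + (n/2)δ_ij, M_ij, Δ_ij}` is closed under brackets (a Lie subalgebra of `𝔻(V)`,
isomorphic to `𝔰𝔭(k)` by Theorem 5.6.9). -/

omit [DecidableEq τ] [DecidableEq ι] in
/-- (5.79) as brackets: `⁅Δ_ij, Δ_rs⁆ = 0`. [cite: GoodmanWallachGTM255, Theorem 5.6.9 (proof, (5.79))] -/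
theorem lie_laplacian_laplacian (Δ : ι → ι → MvPolynomial (τ × ι) R →ₗ[R] MvPolynomial (τ × ι) R)
    (hΔ : ∀ i j f, Δ i j f = ∑ p : τ, pderiv (p, i) (pderiv (p, j) f)) (i j r s : ι) :
    ⁅Δ i j, Δ r s⁆ = 0 := by
  refine LinearMap.ext fun f => ?_
  rw [Ring.lie_def, LinearMap.sub_apply, Module.End.mul_apply, Module.End.mul_apply,
    laplacian_comm Δ hΔ, sub_self, LinearMap.zero_apply]

omit [Fintype τ] [DecidableEq τ] [DecidableEq ι] in
/-- (5.79) as brackets: `⁅M_ij, M_rs⁆ = 0`. [cite: GoodmanWallachGTM255, Theorem 5.6.9 (proof, (5.79))] -/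
theorem lie_M_M (M : ι → ι → MvPolynomial (τ × ι) R) (i j r s : ι) :
    ⁅LinearMap.mulLeft R (M i j), LinearMap.mulLeft R (M r s)⁆ = 0 := by
  refine LinearMap.ext fun f => ?_
  rw [Ring.lie_def, LinearMap.sub_apply, Module.End.mul_apply, Module.End.mul_apply,
    LinearMap.mulLeft_apply, LinearMap.mulLeft_apply, LinearMap.mulLeft_apply,
    LinearMap.mulLeft_apply, M_mul_comm, sub_self, LinearMap.zero_apply]

/-- **(5.80) as a bracket**: `⁅Δ_ij, M_rs⁆ = δ_ri E_sj + δ_si E_rj + δ_rj E_si + δ_sj E_ri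
+ n(δ_ri δ_sj + δ_si δ_rj)·1`. [cite: GoodmanWallachGTM255, Theorem 5.6.9 (proof, (5.80))] -/
theorem lie_laplacian_M (Δ : ι → ι → MvPolynomial (τ × ι) R →ₗ[R] MvPolynomial (τ × ι) R)
    (hΔ : ∀ i j f, Δ i j f = ∑ p : τ, pderiv (p, i) (pderiv (p, j) f))
    (M : ι → ι → MvPolynomial (τ × ι) R) (hM : ∀ i j, M i j = ∑ p : τ, X (p, i) * X (p, j))
    (E : ι → ι → MvPolynomial (τ × ι) R →ₗ[R] MvPolynomial (τ × ι) R)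
    (hE : ∀ i j f, E i j f = ∑ p : τ, X (p, i) * pderiv (p, j) f) (i j r s : ι) :
    ⁅Δ i j, LinearMap.mulLeft R (M r s)⁆ =
      (if r = i then (1 : R) else 0) • E s j + (if s = i then (1 : R) else 0) • E r j +
        (if r = j then (1 : R) else 0) • E s i + (if s = j then (1 : R) else 0) • E r i +
        ((Fintype.card τ : R) * ((if r = i then (1 : R) else 0) * (if s = j then (1 : R) else 0) +
          (if s = i then (1 : R) else 0) * (if r = j then (1 : R) else 0))) •
          (1 : MvPolynomial (τ × ι) R →ₗ[R] MvPolynomial (τ × ι) R) := by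
  refine LinearMap.ext fun f => ?_
  rw [Ring.lie_def, LinearMap.sub_apply, Module.End.mul_apply, Module.End.mul_apply,
    LinearMap.mulLeft_apply, LinearMap.mulLeft_apply, laplacian_M_comm Δ hΔ M hM E hE]
  simp only [LinearMap.add_apply, LinearMap.smul_apply, Module.End.one_apply]

/-- **(5.81) as a bracket**: `⁅E_ij, E_rs⁆ = δ_jr E_is − δ_is E_rj`.
[cite: GoodmanWallachGTM255, Theorem 5.6.9 (proof, (5.81))] -/
theorem lie_euler_euler (E : ι → ι → MvPolynomial (τ × ι) R →ₗ[R] MvPolynomial (τ × ι) R)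
    (hE : ∀ i j f, E i j f = ∑ p : τ, X (p, i) * pderiv (p, j) f) (i j r s : ι) :
    ⁅E i j, E r s⁆ = (if r = j then (1 : R) else 0) • E i s - (if i = s then (1 : R) else 0) • E r j := by
  refine LinearMap.ext fun f => ?_
  rw [Ring.lie_def, LinearMap.sub_apply, Module.End.mul_apply, Module.End.mul_apply,
    euler_euler_comm E hE, LinearMap.sub_apply, LinearMap.smul_apply, LinearMap.smul_apply]

/-- **(5.82) as a bracket**: `⁅E_ij, M_rs⁆ = δ_jr M_is + δ_js M_ir`.
[cite: GoodmanWallachGTM255, Theorem 5.6.9 (proof, (5.82))] -/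
theorem lie_euler_M (E : ι → ι → MvPolynomial (τ × ι) R →ₗ[R] MvPolynomial (τ × ι) R)
    (hE : ∀ i j f, E i j f = ∑ p : τ, X (p, i) * pderiv (p, j) f)
    (M : ι → ι → MvPolynomial (τ × ι) R) (hM : ∀ i j, M i j = ∑ p : τ, X (p, i) * X (p, j))
    (i j r s : ι) :
    ⁅E i j, LinearMap.mulLeft R (M r s)⁆ =
      (if r = j then (1 : R) else 0) • LinearMap.mulLeft R (M i s) +
        (if s = j then (1 : R) else 0) • LinearMap.mulLeft R (M i r) := by
  refine LinearMap.ext fun f => ?_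
  rw [Ring.lie_def, LinearMap.sub_apply, Module.End.mul_apply, Module.End.mul_apply,
    LinearMap.mulLeft_apply, LinearMap.mulLeft_apply, euler_M_comm E hE M hM]
  simp only [LinearMap.add_apply, LinearMap.smul_apply, LinearMap.mulLeft_apply, add_mul,
    smul_mul_assoc]

/-- **(5.83) as a bracket**: `⁅E_ij, Δ_rs⁆ = −δ_ir Δ_js − δ_is Δ_jr`.
[cite: GoodmanWallachGTM255, Theorem 5.6.9 (proof, (5.83))] -/
theorem lie_euler_laplacian (Δ : ι → ι → MvPolynomial (τ × ι) R →ₗ[R] MvPolynomial (τ × ι) R)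
    (hΔ : ∀ i j f, Δ i j f = ∑ p : τ, pderiv (p, i) (pderiv (p, j) f))
    (E : ι → ι → MvPolynomial (τ × ι) R →ₗ[R] MvPolynomial (τ × ι) R)
    (hE : ∀ i j f, E i j f = ∑ p : τ, X (p, i) * pderiv (p, j) f) (i j r s : ι) :
    ⁅E i j, Δ r s⁆ =
      -((if i = r then (1 : R) else 0) • Δ j s) - (if i = s then (1 : R) else 0) • Δ j r := by
  refine LinearMap.ext fun f => ?_
  rw [Ring.lie_def, LinearMap.sub_apply, Module.End.mul_apply, Module.End.mul_apply,
    euler_laplacian_comm Δ hΔ E hE, LinearMap.sub_apply, LinearMap.neg_apply, LinearMap.smul_apply,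
    LinearMap.smul_apply]

/-! ## § 3. Invariance under `GL(n)` and `O(n)` acting on the left index -/

omit [Fintype τ] [DecidableEq τ] [DecidableEq ι] in
/-- A linear substitution fixes scalars. [folklore] -/
private theorem aeval_C' (v : τ × ι → MvPolynomial (τ × ι) R) (c : R) :
    aeval v (C c : MvPolynomial (τ × ι) R) = C c := by
  rw [aeval_C]; rfl

/-- **The chain rule for the substitution `x ↦ a x`** (`(a x)_{pi} = ∑_q a_{pq} x_{qi}`):
`∂_{qj} (f(a x)) = ∑_p a_{pq} (∂_{pj} f)(a x)`. This is the display
`ρ(g) ∂/∂x_{pi} ρ(g⁻¹) = ∑_q g_{qp} ∂/∂x_{qi}` of § 5.6.3 (with `ρ(g)f(x) = f(g⁻¹x)`).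
[cite: GoodmanWallachGTM255, §5.6.3 (display preceding Theorem 5.6.9)] -/
theorem pderiv_aeval_linSubst (a : Matrix τ τ R) (v : τ × ι → MvPolynomial (τ × ι) R)
    (hv : ∀ p i, v (p, i) = ∑ q : τ, C (a p q) * X (q, i)) (q : τ) (j : ι)
    (f : MvPolynomial (τ × ι) R) :
    pderiv (q, j) (aeval v f) = ∑ p : τ, C (a p q) * aeval v (pderiv (p, j) f) := by
  have hdv : ∀ (p : τ) (i : ι), pderiv (q, j) (v (p, i)) = if i = j then C (a p q) else 0 := by
    intro p i
    rw [hv, map_sum, Finset.sum_eq_single q]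
    · rw [pderiv_C_mul, pderiv_X_pair]
      simp only [true_and, mul_ite, mul_one, mul_zero]
    · intro q' _ hq'
      rw [pderiv_C_mul, pderiv_X_pair, if_neg (fun h => hq' h.1), mul_zero]
    · intro h; exact absurd (Finset.mem_univ q) h
  induction f using MvPolynomial.induction_on with
  | C c =>
    simp only [pderiv_C, map_zero, mul_zero, Finset.sum_const_zero, aeval_C']
  | add f g hf hg =>
    rw [map_add, map_add, hf, hg, ← Finset.sum_add_distrib]
    refine Finset.sum_congr rfl fun p _ => ?_
    rw [map_add, map_add, mul_add]
  | mul_X f x hf =>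
    obtain ⟨p₀, i₀⟩ := x
    have hr : ∀ p : τ, C (a p q) * aeval v (pderiv (p, j) (f * X (p₀, i₀))) =
        C (a p q) * aeval v (pderiv (p, j) f) * v (p₀, i₀) +
          (if p₀ = p ∧ i₀ = j then C (a p q) * aeval v f else 0) := by
      intro p
      rw [pderiv_mul, pderiv_X_pair]
      split_ifs with h
      · rw [mul_one, map_add, map_mul, aeval_X]; ring
      · rw [mul_zero, add_zero, map_mul, aeval_X]; ring
    have hs : ∑ p : τ, (if p₀ = p ∧ i₀ = j then C (a p q) * aeval v f else 0) =
        if i₀ = j then C (a p₀ q) * aeval v f else 0 := by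
      rw [Finset.sum_eq_single p₀]
      · simp only [true_and]
      · intro p _ hp
        rw [if_neg (fun h => hp h.1.symm)]
      · intro h; exact absurd (Finset.mem_univ p₀) h
    rw [map_mul, aeval_X, pderiv_mul, hf, hdv, Finset.sum_congr rfl fun p _ => hr p,
      Finset.sum_add_distrib, hs, Finset.sum_mul]
    split_ifs <;> ring

/-- **`E_ij` commutes with every linear substitution of the left index** (`E_ij ∈ 𝔻(V)^{GL(n)}`:
the `𝔤𝔩(k)` vector fields of the right action commute with the left action of `GL(n)`).
[cite: GoodmanWallachGTM255, §5.6.2 (5.75) and Theorem 5.6.5] -/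
theorem euler_aeval_linSubst (E : ι → ι → MvPolynomial (τ × ι) R →ₗ[R] MvPolynomial (τ × ι) R)
    (hE : ∀ i j f, E i j f = ∑ p : τ, X (p, i) * pderiv (p, j) f) (a : Matrix τ τ R)
    (v : τ × ι → MvPolynomial (τ × ι) R) (hv : ∀ p i, v (p, i) = ∑ q : τ, C (a p q) * X (q, i))
    (i j : ι) (f : MvPolynomial (τ × ι) R) : E i j (aeval v f) = aeval v (E i j f) := by
  rw [hE, hE, map_sum]
  simp_rw [pderiv_aeval_linSubst a v hv, map_mul, aeval_X, Finset.mul_sum]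
  rw [Finset.sum_comm]
  refine Finset.sum_congr rfl fun p _ => ?_
  rw [hv, Finset.sum_mul]
  refine Finset.sum_congr rfl fun q _ => ?_
  ring

omit [DecidableEq ι] in
/-- **`M_ij` is `O(n)`-invariant**: `(x_i, x_j)(a x) = (x_i, x_j)(x)` when `aᵀ a = 1`.
[cite: GoodmanWallachGTM255, §5.6.3 ("M_ij is multiplication by the G-invariant function (x_i, x_j)")] -/
theorem aeval_linSubst_M (M : ι → ι → MvPolynomial (τ × ι) R)
    (hM : ∀ i j, M i j = ∑ p : τ, X (p, i) * X (p, j)) (a : Matrix τ τ R)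
    (ha : a.transpose * a = 1) (v : τ × ι → MvPolynomial (τ × ι) R)
    (hv : ∀ p i, v (p, i) = ∑ q : τ, C (a p q) * X (q, i)) (i j : ι) :
    aeval v (M i j) = M i j := by
  have hsum : ∀ q q' : τ, ∑ p : τ, a p q * a p q' = if q = q' then 1 else 0 := by
    intro q q'
    have := congrFun (congrFun ha q) q'
    rw [Matrix.mul_apply, Matrix.one_apply] at this
    simpa [Matrix.transpose_apply] using this
  rw [hM, map_sum]
  simp_rw [map_mul, aeval_X, hv]
  -- expand the product of the two sums and resum over `p` first
  calc ∑ p : τ, (∑ q : τ, C (a p q) * X (q, i)) * (∑ q' : τ, C (a p q') * X (q', j))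
      = ∑ p : τ, ∑ q : τ, ∑ q' : τ, C (a p q) * C (a p q') * (X (q, i) * X (q', j)) := by
        refine Finset.sum_congr rfl fun p _ => ?_
        rw [Finset.sum_mul_sum]
        refine Finset.sum_congr rfl fun q _ => Finset.sum_congr rfl fun q' _ => ?_
        ring
    _ = ∑ q : τ, ∑ q' : τ, ∑ p : τ, C (a p q) * C (a p q') * (X (q, i) * X (q', j)) := by
        rw [Finset.sum_comm]
        exact Finset.sum_congr rfl fun q _ => Finset.sum_comm
    _ = ∑ q : τ, ∑ q' : τ, C (∑ p : τ, a p q * a p q') * (X (q, i) * X (q', j)) := by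
        refine Finset.sum_congr rfl fun q _ => Finset.sum_congr rfl fun q' _ => ?_
        rw [← Finset.sum_mul, map_sum]
        refine congrArg (· * _) (Finset.sum_congr rfl fun p _ => ?_)
        rw [map_mul]
    _ = ∑ q : τ, X (q, i) * X (q, j) := by
        refine Finset.sum_congr rfl fun q _ => ?_
        rw [Finset.sum_eq_single q]
        · rw [hsum, if_pos rfl, map_one, one_mul]
        · intro q' _ hq'
          rw [hsum, if_neg (Ne.symm hq'), map_zero, zero_mul]
        · intro h; exact absurd (Finset.mem_univ q) h

/-- **`Δ_ij` is `O(n)`-invariant**: `Δ_ij (f(a x)) = (Δ_ij f)(a x)` when `a aᵀ = 1`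
(`ρ(g) Δ_ij ρ(g⁻¹) = ∑_{q,r} {∑_p g_{qp} g_{rp}} ∂²/∂x_{qi}∂x_{rj} = Δ_ij` for `g gᵀ = I`).
[cite: GoodmanWallachGTM255, §5.6.3 (display preceding Theorem 5.6.9)] -/
theorem laplacian_aeval_linSubst
    (Δ : ι → ι → MvPolynomial (τ × ι) R →ₗ[R] MvPolynomial (τ × ι) R)
    (hΔ : ∀ i j f, Δ i j f = ∑ p : τ, pderiv (p, i) (pderiv (p, j) f)) (a : Matrix τ τ R)
    (ha : a * a.transpose = 1) (v : τ × ι → MvPolynomial (τ × ι) R)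
    (hv : ∀ p i, v (p, i) = ∑ q : τ, C (a p q) * X (q, i)) (i j : ι)
    (f : MvPolynomial (τ × ι) R) : Δ i j (aeval v f) = aeval v (Δ i j f) := by
  have hsum : ∀ p p' : τ, ∑ q : τ, a p q * a p' q = if p = p' then 1 else 0 := by
    intro p p'
    have := congrFun (congrFun ha p) p'
    rw [Matrix.mul_apply, Matrix.one_apply] at this
    simpa [Matrix.transpose_apply] using this
  rw [hΔ, hΔ, map_sum]
  simp_rw [pderiv_aeval_linSubst a v hv, map_sum, pderiv_C_mul, pderiv_aeval_linSubst a v hv,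
    Finset.mul_sum]
  -- `∑_q ∑_p ∑_p' a_pq a_p'q (∂_{p'i} ∂_{pj} f)(ax) = ∑_p (∂_{pi} ∂_{pj} f)(ax)`
  calc ∑ q : τ, ∑ p : τ, ∑ p' : τ, C (a p q) * (C (a p' q) * aeval v (pderiv (p', i) (pderiv (p, j) f)))
      = ∑ p : τ, ∑ p' : τ, C (∑ q : τ, a p q * a p' q) * aeval v (pderiv (p', i) (pderiv (p, j) f)) := by
        rw [Finset.sum_comm]
        refine Finset.sum_congr rfl fun p _ => ?_
        rw [Finset.sum_comm]
        refine Finset.sum_congr rfl fun p' _ => ?_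
        rw [map_sum, Finset.sum_mul]
        refine Finset.sum_congr rfl fun q _ => ?_
        rw [map_mul, mul_assoc]
    _ = ∑ p : τ, aeval v (pderiv (p, i) (pderiv (p, j) f)) := by
        refine Finset.sum_congr rfl fun p _ => ?_
        rw [Finset.sum_eq_single p]
        · rw [hsum, if_pos rfl, map_one, one_mul, pderiv_comm']
        · intro p' _ hp'
          rw [hsum, if_neg (Ne.symm hp'), map_zero, zero_mul]
        · intro h; exact absurd (Finset.mem_univ p) h

end Literature.RepresentationTheory.ClassicalInvariants.OnSpDualityOperators
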